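import Summits.Ventures.PercRepro.PuncturedLYMCoHyp
import Summits.Ventures.PercRepro.PuncturedLYMCoHypSeq
import Summits.Ventures.PercRepro.PuncturedLYMCoHypSeq2
import Summits.Ventures.PercRepro.PuncturedLYMPaving

/-!
# PercRepro — ONE CO-HYPERPLANE OF ANY SIZE, PART 3: THE THEOREM — (SP) FOR THE `j`-SETS CONTAINING ANY SET `C`
WITH `1 ≤ #C ≤ j`, `2j + 1 ≤ n`, AND (NC) FOR EVERY PAVING MATROID WITH ONE NONTRIVIAL HYPERPLANE (p10, gen 33)

* `card_upLevel` — the `j`-sets containing `C` number `C(n − m, j − m)` (`m = #C ≤ j`), so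
  `#P = C(n, j) − C(n − m, j − m)` (`card_punctured_upLevel`);
* **`puncturedNMP_upLevel`** — **the punctured level of `upLevel j C` has the normalised matching property against the
  level above, for every `C` with `1 ≤ #C ≤ j` and `2j + 1 ≤ n`**: the explicit sequences of part 2 satisfy the row
  and column identities of part 1 and are nonnegative.  For `#C = j` this is (SP) for the single-word code `{C}`.
* **`Cogirth.normConsAt_of_oneHyperplane`** — **(NC) holds for every paving matroid on `E = univ` with
  `r + 1 ≤ n ≤ 2r − 2` whose dependent `r`-sets are exactly the `r`-subsets of one set `H` (`r ≤ #H < n`)** — the paving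
  matroids with a single nontrivial hyperplane, of any size: its co-code is `upLevel (n − r) (univ ∖ H)`
  (`cocode_eq_upLevel`), and the paving bridge finishes.
In the dictionary of S5 this settles the bottom step of (NC) — conjecture (PAV) — on the one-hyperplane paving
matroids (the sparse-paving single-word case extended to co-hyperplanes of every size `1 ≤ m ≤ j`).  Nothing here
asserts (SP), (PAV) or (NC) in general.
-/

open scoped Matroid

namespace PercRepro.PuncturedLYM

open Finset

variable {α : Type} [Fintype α] [DecidableEq α]

/-- The `j`-sets containing `C` are the unions `X' ∪ C` with `X'` a `(j − m)`-subset of `univ ∖ C`. -/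
theorem upLevel_eq_image {j : ℕ} {C : Finset α} (hmj : C.card ≤ j) :
    upLevel j C = ((univ \ C).powersetCard (j - C.card)).image (fun X' => X' ∪ C) := by
  ext X
  simp only [mem_upLevel, mem_image, mem_powersetCard]
  constructor
  · rintro ⟨hX, hCX⟩
    refine ⟨X \ C, ⟨sdiff_subset_sdiff (subset_univ X) le_rfl, ?_⟩, ?_⟩
    · rw [card_sdiff_of_subset hCX, hX]
    · exact sdiff_union_of_subset hCX
  · rintro ⟨X', ⟨hX'C, hX'c⟩, rfl⟩
    refine ⟨?_, subset_union_right⟩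
    have hdisj : Disjoint X' C := by
      rw [disjoint_iff_inter_eq_empty]
      ext z
      simp only [mem_inter, notMem_empty, iff_false, not_and]
      intro hz
      have := hX'C hz
      rw [mem_sdiff] at this
      exact this.2
    rw [card_union_of_disjoint hdisj, hX'c]
    omega

/-- `X' ↦ X' ∪ C` is injective on the subsets of `univ ∖ C`. -/
theorem union_C_injOn (C : Finset α) {j : ℕ} :
    Set.InjOn (fun X' => X' ∪ C) (((univ \ C).powersetCard j : Finset (Finset α)) : Set (Finset α)) := by
  intro X' hX' X'' hX'' h
  rw [mem_coe, mem_powersetCard] at hX' hX''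
  have h' : X' ∪ C = X'' ∪ C := h
  ext z
  constructor
  · intro hz
    have hzC : z ∉ C := by
      have := hX'.1 hz
      rw [mem_sdiff] at this
      exact this.2
    have : z ∈ X'' ∪ C := h' ▸ mem_union_left C hz
    exact (mem_union.1 this).resolve_right hzC
  · intro hz
    have hzC : z ∉ C := by
      have := hX''.1 hz
      rw [mem_sdiff] at this
      exact this.2
    have : z ∈ X' ∪ C := h'.symm ▸ mem_union_left C hz
    exact (mem_union.1 this).resolve_right hzC

/-- **The number of `j`-sets containing `C`** is `C(n − m, j − m)` (`m = #C ≤ j`). -/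
theorem card_upLevel {j : ℕ} {C : Finset α} (hmj : C.card ≤ j) :
    (upLevel j C).card = (Fintype.card α - C.card).choose (j - C.card) := by
  rw [upLevel_eq_image hmj, card_image_of_injOn (union_C_injOn C), card_powersetCard, card_univ_sdiff]

/-- `#P = C(n, j) − C(n − m, j − m)` for `upLevel j C`. -/
theorem card_punctured_upLevel {j : ℕ} {C : Finset α} (hmj : C.card ≤ j) :
    (punctured j (upLevel j C)).card + (Fintype.card α - C.card).choose (j - C.card) =
      (Fintype.card α).choose j := by
  unfold punctured
  have hsub : upLevel j C ⊆ (univ : Finset α).powersetCard j := by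
    intro X hX
    rw [mem_upLevel] at hX
    rw [mem_powersetCard]
    exact ⟨subset_univ X, hX.1⟩
  have := card_sdiff_add_card_eq_card hsub
  rw [card_upLevel hmj, card_powersetCard, card_univ] at this
  exact this

/-- **THE THEOREM: (SP) for the `j`-sets containing `C`**, for every `C` with `1 ≤ #C ≤ j` and `2j + 1 ≤ n`. -/
theorem puncturedNMP_upLevel {j : ℕ} {C : Finset α} (hm : 1 ≤ C.card) (hmj : C.card ≤ j)
    (hn : 2 * j + 1 ≤ Fintype.card α) : PuncturedNMP j (upLevel j C) := by
  set n := Fintype.card α with hn_def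
  set m := C.card with hm_def
  have hjn : j < n := by omega
  apply puncturedNMP_upLevel_of_seq hjn (coXv n j m) (coYv n j m) (coK n j m)
  · -- `k · #Y = #P`
    have hY : (levelAbove α j).card = n.choose (j + 1) := by
      unfold levelAbove
      rw [card_powersetCard, card_univ]
    have hP := card_punctured_upLevel (j := j) (C := C) hmj
    have hPq : ((punctured j (upLevel j C)).card : ℚ) = coP n j m := by
      unfold coP
      have : ((punctured j (upLevel j C)).card : ℚ) + ((n - m).choose (j - m) : ℕ) = (n.choose j : ℚ) := by
        exact_mod_cast hP
      linarith
    rw [hY, hPq]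
    unfold coK
    have hYpos : (0 : ℚ) < (n.choose (j + 1) : ℕ) := by exact_mod_cast Nat.choose_pos (by omega)
    field_simp
  · intro c hc
    exact coSeq_nonneg hm hmj hn hc
  · intro c hc
    exact coSeq_row hm hmj hn hc
  · exact coSeq_col0 n j m
  · intro c' hc1 hc
    exact coSeq_col hm hmj hn hc1 hc
  · exact coSeq_top hm hmj hn

end PercRepro.PuncturedLYM

namespace PercRepro.Cogirth

open Finset ThmH Skew

variable {α : Type} [Fintype α] [DecidableEq α] {M : Matroid α} [M.Finite]

/-- If the dependent `r`-sets of `M` are exactly the `r`-subsets of `H` (`E = univ`, `r ≤ n`), the co-code is the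
family of `(n − r)`-sets containing `univ ∖ H`. -/
theorem cocode_eq_upLevel {r : ℕ} (hE : gr M = univ) (hr : r ≤ (gr M).card) {H : Finset α}
    (hH : ∀ S ⊆ gr M, S.card = r → (rk M S ≠ S.card ↔ S ⊆ H)) :
    cocode M r = PuncturedLYM.upLevel ((gr M).card - r) (univ \ H) := by
  ext X
  rw [mem_cocode, PuncturedLYM.mem_upLevel]
  constructor
  · rintro ⟨⟨hXg, hXc⟩, hdep⟩
    refine ⟨hXc, ?_⟩
    have hSc : (gr M \ X).card = r := by
      rw [card_sdiff_of_subset hXg, hXc]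
      omega
    have hSH : gr M \ X ⊆ H := (hH _ sdiff_subset hSc).1 hdep
    intro z hz
    rw [mem_sdiff] at hz
    by_contra hzX
    have hz' : z ∈ gr M \ X := mem_sdiff.2 ⟨by rw [hE]; exact mem_univ z, hzX⟩
    exact hz.2 (hSH hz')
  · rintro ⟨hXc, hHX⟩
    have hXg : X ⊆ gr M := by rw [hE]; exact subset_univ X
    refine ⟨⟨hXg, hXc⟩, ?_⟩
    have hSc : (gr M \ X).card = r := by
      rw [card_sdiff_of_subset hXg, hXc]
      omega
    apply (hH _ sdiff_subset hSc).2
    intro z hz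
    rw [mem_sdiff] at hz
    by_contra hzH
    have hz' : z ∈ univ \ H := mem_sdiff.2 ⟨mem_univ z, hzH⟩
    exact hz.2 (hHX hz')

/-- **(NC) FOR EVERY PAVING MATROID WITH ONE NONTRIVIAL HYPERPLANE**: `M` paving of rank `r` on `E = univ` with
`r + 1 ≤ n ≤ 2r − 2`, whose dependent `r`-sets are exactly the `r`-subsets of a set `H` with `r ≤ #H < n`. -/
theorem normConsAt_of_oneHyperplane {r : ℕ} (hp : IsPaving M) (hrk : rk M (gr M) = r) (hE : gr M = univ)
    (hr1 : r + 1 ≤ (gr M).card) (hn : (gr M).card + 2 ≤ 2 * r) {H : Finset α} (hrH : r ≤ H.card)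
    (hHn : H.card < (gr M).card) (hH : ∀ S ⊆ gr M, S.card = r → (rk M S ≠ S.card ↔ S ⊆ H)) :
    NormConsAt M := by
  apply normConsAt_of_paving_of_puncturedNMP hp hrk hE hr1 hn
  rw [cocode_eq_upLevel hE (by omega) hH]
  have hcard : Fintype.card α = (gr M).card := by rw [hE, card_univ]
  apply PuncturedLYM.puncturedNMP_upLevel
  · rw [card_univ_sdiff]
    omega
  · rw [card_univ_sdiff]
    omega
  · omega

end PercRepro.Cogirth
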